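import Summits.BirchSwinnertonDyer.BirchSwinnertonDyer.Theorems.GenusKolyvaginAtTwoGenusPrimitiveSupplyAtTwoTwistRamifiedTransversal
import Literature.NumberTheory.DiophantineGeometry.AbcWave0UniformABCProofs
import HarnessLib

/-!
# Route `GenusKolyvaginAtTwo`, crux #2 `GenusPrimitiveSupplyAtTwo` (stmt-BirchSwinnertonDyer-22136):
# Mazur–Rubin Lemma 2.11 at `p = 2` over `ℚ` — the prime-twist instance `d = ±ℓ·u²`-free form `v_ℓ(d) = 1`

Lead seat `bsd-line-gk2-p1` g7 (cell `bsd-f1-sign2`). THEOREMS ONLY (no definition, no named fact, no `sorry`); helper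
`--supports stmt-BirchSwinnertonDyer-22136`; no item is closed; BSD is not proved by any of this.

The cell's twists are `W^{(ℓ*)}`, `ℓ* = ±ℓ`, at a Kolyvagin prime `ℓ` of good reduction (gk2-p4's capstone
`exists_kolyvaginPrime_genusPair_selmer_of_cor34i`, gk2-p5's `supply_DEF1_*`, the lead's `…AuxiliaryFieldRowOne*`). This file
supplies the `ℚ`-level inputs of `…TwistRamifiedTransversal` (p622198) for them:

* `valuation_natCast_eq_exp_neg_one_of_mem` — for a prime `ℓ` under the place `v` of `ℚ`, `v(ℓ) = exp(-1)` (so `±ℓ` is a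
  uniformiser at `v`); `exists_uniformizer_sq_mul_of_valuation_eq` — `v(d) = exp(-1)` gives the hypothesis `hram` of p622198
  with `(π, c) = (d, 1)`;
* `map_kummerLocalConditionAt_inf_eq_bot_of_twist_rat` — the transversality `htr` over `ℚ` for ANY `d` with `v(d) = exp(-1)`
  (e.g. `d = ±ℓ`), ANY model `Wd` of `W^{(d)}`, `W` good at `v ∤ 2`, and EVERY intertwining pair `Wd[2] ⇄ W[2]`;
* `map_kummerLocalConditionAt_inf_eq_bot_of_twist_prime` — the same with `d = ℓ` or `d = -ℓ` spelled out;
* §8 (APPEND) `closureEmb_geomSqrt_not_mem_maxUnramified` (+ `_rat`, `_prime`) — bridge to gk2-p5's currency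
  `ι(√d) ∉ K_v^{nr}` (hypothesis of `exists_intertwining_hsplit_and_transverse`, p622452) from the valuation form.

References: [MazurRubin2010] Lemma 2.11; [SerreLocalFields1979] Ch. I §4 (valuation of a prime at its place).
-/

set_option linter.dupNamespace false -- tree convention: `Summit.BirchSwinnertonDyer.BirchSwinnertonDyer.Theorems` (summit = sub-problem)
set_option autoImplicit false

noncomputable section

open scoped Classical ContRepresentation

namespace Summit.BirchSwinnertonDyer.BirchSwinnertonDyer.Theorems.GenusKolyTwistRamified

open WeierstrassCurve Field NumberField IsDedekindDomain Function
open Literature.NumberTheory.EllipticCurves Literature.NumberTheory.GaloisRepresentations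
open Literature.NumberTheory.GaloisCohomology
open Literature.NumberTheory.DiophantineGeometry.UniformABCConjecture (natCast_mem_asIdeal_iff asIdeal_eq_span_natGenerator)

/-! ## §6 `v(ℓ) = exp(-1)` at the place of `ℚ` over the prime `ℓ` -/

/-- **The valuation of a prime at its own place of `ℚ` is `exp(-1)`**: if `ℓ` is prime and `ℓ ∈ v`, then
`v = (ℓ)` (`𝓞 ℚ ≅ ℤ`) and `v(ℓ) = exp(-1)` (Mathlib `intValuation_singleton`). [folklore] -/
theorem valuation_natCast_eq_exp_neg_one_of_mem (v : HeightOneSpectrum (𝓞 ℚ)) {ℓ : ℕ} (hℓ : ℓ.Prime)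
    (hv : (ℓ : 𝓞 ℚ) ∈ v.asIdeal) : v.valuation ℚ (ℓ : ℚ) = WithZero.exp (-1 : ℤ) := by
  have hgen : Rat.HeightOneSpectrum.natGenerator v = ℓ := by
    have hdvd := (natCast_mem_asIdeal_iff v ℓ).mp hv
    exact ((Nat.prime_dvd_prime_iff_eq (Rat.HeightOneSpectrum.prime_natGenerator v) hℓ).mp hdvd)
  have hspan : v.asIdeal = Ideal.span {(ℓ : 𝓞 ℚ)} := by
    rw [asIdeal_eq_span_natGenerator v, hgen]
  have hℓ0 : (ℓ : 𝓞 ℚ) ≠ 0 := by exact_mod_cast hℓ.ne_zero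
  rw [← map_natCast (algebraMap (𝓞 ℚ) ℚ) ℓ, HeightOneSpectrum.valuation_of_algebraMap,
    HeightOneSpectrum.intValuation_singleton v hℓ0 hspan]

/-- `v(-ℓ) = exp(-1)` as well. [folklore] -/
theorem valuation_neg_natCast_eq_exp_neg_one_of_mem (v : HeightOneSpectrum (𝓞 ℚ)) {ℓ : ℕ} (hℓ : ℓ.Prime)
    (hv : (ℓ : 𝓞 ℚ) ∈ v.asIdeal) : v.valuation ℚ (-(ℓ : ℚ)) = WithZero.exp (-1 : ℤ) := by
  rw [Valuation.map_neg, valuation_natCast_eq_exp_neg_one_of_mem v hℓ hv]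

/-- An element of valuation `exp(-1)` is of the shape `c² π` with `π` a uniformiser (`c = 1`): the hypothesis `hram` of
`…TwistRamifiedTransversal`. [folklore] -/
theorem exists_uniformizer_sq_mul_of_valuation_eq {K : Type} [Field K] [NumberField K]
    (v : HeightOneSpectrum (𝓞 K)) {d : K} (hdv : v.valuation K d = WithZero.exp (-1 : ℤ)) :
    ∃ π c : K, v.valuation K π = WithZero.exp (-1 : ℤ) ∧ d = c ^ 2 * π :=
  ⟨d, 1, hdv, by rw [one_pow, one_mul]⟩

/-! ## §7 The transversality over `ℚ` for twists by an element of valuation one at `v` (e.g. `±ℓ`) -/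

variable (W : WeierstrassCurve ℚ) [W.IsElliptic]

/-- **Mazur–Rubin Lemma 2.11 over `ℚ`, `htr` form**: for `W` good at the odd place `v`, `d` with `v(d) = exp(-1)` and any
model `Wd` of `W^{(d)}`, the transported Kummer condition of `Wd` is transverse to that of `W` at `ℚ_v`, for every
intertwining pair `φ : Wd[2] ⇄ W[2] : ψ`. [cite: MazurRubin2010, Lemma 2.11 (arXiv:0904.3709 p. 7)] -/
theorem map_kummerLocalConditionAt_inf_eq_bot_of_twist_rat {d : ℚ}
    {Wd : WeierstrassCurve ℚ} [Wd.IsElliptic] {C : VariableChange ℚ} (hWd : C • W.quadraticTwist d = Wd)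
    (v : HeightOneSpectrum (𝓞 ℚ)) (h2v : ((2 : ℕ) : 𝓞 ℚ) ∉ v.asIdeal) (hW : W.HasGoodReductionAt v)
    (hdv : v.valuation ℚ d = WithZero.exp (-1 : ℤ))
    (φ : (Wd.torsionGaloisModule ((2 : ℕ) : ℤ)).toContRepresentation →ⁱL
      (W.torsionGaloisModule ((2 : ℕ) : ℤ)).toContRepresentation)
    (ψ : (W.torsionGaloisModule ((2 : ℕ) : ℤ)).toContRepresentation →ⁱL
      (Wd.torsionGaloisModule ((2 : ℕ) : ℤ)).toContRepresentation)
    (hψφ : ∀ a, ψ (φ a) = a) :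
    (Wd.kummerLocalConditionAt ((2 : ℕ) : ℤ) (v.adicCompletion ℚ)).map
        (galoisCohomology.map (φ.restrictField (v.adicCompletion ℚ)) 1) ⊓
      W.kummerLocalConditionAt ((2 : ℕ) : ℤ) (v.adicCompletion ℚ) = ⊥ := by
  have hd : d ≠ 0 := by
    intro h
    rw [h, map_zero] at hdv
    exact WithZero.zero_ne_coe hdv
  exact map_kummerLocalConditionAt_inf_eq_bot_of_twist_ramified W hd hWd v h2v hW
    (exists_uniformizer_sq_mul_of_valuation_eq v hdv) φ ψ hψφ

/-- **The prime-twist instance `d = ±ℓ`** (the cell's `W^{(ℓ*)}` at a Kolyvagin prime `ℓ` of good reduction):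
transversality at `ℚ_ℓ` for every model of `W^{(ℓ)}` or `W^{(-ℓ)}` and every intertwining pair.
[cite: MazurRubin2010, Lemma 2.11 (arXiv:0904.3709 p. 7)] -/
theorem map_kummerLocalConditionAt_inf_eq_bot_of_twist_prime {ℓ : ℕ} (hℓ : ℓ.Prime) {d : ℚ}
    (hdℓ : d = ℓ ∨ d = -(ℓ : ℚ))
    {Wd : WeierstrassCurve ℚ} [Wd.IsElliptic] {C : VariableChange ℚ} (hWd : C • W.quadraticTwist d = Wd)
    (v : HeightOneSpectrum (𝓞 ℚ)) (hv : (ℓ : 𝓞 ℚ) ∈ v.asIdeal) (h2v : ((2 : ℕ) : 𝓞 ℚ) ∉ v.asIdeal)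
    (hW : W.HasGoodReductionAt v)
    (φ : (Wd.torsionGaloisModule ((2 : ℕ) : ℤ)).toContRepresentation →ⁱL
      (W.torsionGaloisModule ((2 : ℕ) : ℤ)).toContRepresentation)
    (ψ : (W.torsionGaloisModule ((2 : ℕ) : ℤ)).toContRepresentation →ⁱL
      (Wd.torsionGaloisModule ((2 : ℕ) : ℤ)).toContRepresentation)
    (hψφ : ∀ a, ψ (φ a) = a) :
    (Wd.kummerLocalConditionAt ((2 : ℕ) : ℤ) (v.adicCompletion ℚ)).map
        (galoisCohomology.map (φ.restrictField (v.adicCompletion ℚ)) 1) ⊓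
      W.kummerLocalConditionAt ((2 : ℕ) : ℤ) (v.adicCompletion ℚ) = ⊥ := by
  have hdv : v.valuation ℚ d = WithZero.exp (-1 : ℤ) := by
    rcases hdℓ with rfl | rfl
    · exact valuation_natCast_eq_exp_neg_one_of_mem v hℓ hv
    · exact valuation_neg_natCast_eq_exp_neg_one_of_mem v hℓ hv
  exact map_kummerLocalConditionAt_inf_eq_bot_of_twist_rat W hWd v h2v hW hdv φ ψ hψφ

/-! ## §8 Bridge to gk2-p5's currency: `ι(√d) ∉ K_v^{nr}` from the valuation hypothesis -/

section Bridge

variable {K : Type} [Field K] [NumberField K]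

/-- **The `hram` currency of this lineage implies gk2-p5's**: if `d = c² π` with `π` a uniformiser at `v` (`v(d)` odd), then
the chosen copy `closureEmb(√d)` of `√d` in `K̄_v` lies OUTSIDE the maximal unramified extension `K_v^{nr}` — the hypothesis
of gk2-p5's `exists_intertwining_hsplit_and_transverse` (p622452) at `v`. Proof: the inertia element of
`exists_mem_absInertia_smul_geomSqrt_eq_neg` negates that copy, whereas `I_{K_v}` fixes `K_v^{nr}` pointwise
(`mem_absInertia_iff_forall_mem_maxUnramified`). [cite: SerreInventiones1972, §1.2–§1.3] -/
theorem closureEmb_geomSqrt_not_mem_maxUnramified (v : HeightOneSpectrum (𝓞 K)) {d : K} (hd : d ≠ 0)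
    (hram : ∃ π c : K, v.valuation K π = WithZero.exp (-1 : ℤ) ∧ d = c ^ 2 * π) :
    closureEmb (K := K) (v.adicCompletion K) (geomSqrt d) ∉
      IsNonarchimedeanLocalField.maxUnramified (v.adicCompletion K) := by
  haveI : CharZero (v.adicCompletion K) :=
    charZero_of_injective_algebraMap (algebraMap K (v.adicCompletion K)).injective
  intro hmem
  obtain ⟨τ, hτI, hτs⟩ := exists_mem_absInertia_smul_geomSqrt_eq_neg v hd hram
  have hfix := (IsNonarchimedeanLocalField.mem_absInertia_iff_forall_mem_maxUnramified.mp hτI) _ hmem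
  rw [closureEmb_eq_absClosureEmbedding] at hfix
  have hneg : τ • absClosureEmbedding K (v.adicCompletion K) (geomSqrt d) =
      -absClosureEmbedding K (v.adicCompletion K) (geomSqrt d) := by
    rw [← absGaloisRestrict_apply_smul, hτs, map_neg]
  rw [hneg, neg_eq_iff_add_eq_zero, ← two_mul, mul_eq_zero] at hfix
  rcases hfix with h2 | h0
  · exact (two_ne_zero (α := AlgebraicClosure (v.adicCompletion K))) h2
  · exact geomSqrt_ne_zero hd ((map_eq_zero _).mp h0)

/-- Over `ℚ`: for `d` with `v(d) = exp(-1)` (e.g. `d = ±ℓ` at the place over `ℓ`), `closureEmb(√d) ∉ ℚ_v^{nr}`. [folklore] -/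
theorem closureEmb_geomSqrt_not_mem_maxUnramified_rat (v : HeightOneSpectrum (𝓞 ℚ)) {d : ℚ}
    (hdv : v.valuation ℚ d = WithZero.exp (-1 : ℤ)) :
    closureEmb (K := ℚ) (v.adicCompletion ℚ) (geomSqrt d) ∉
      IsNonarchimedeanLocalField.maxUnramified (v.adicCompletion ℚ) := by
  have hd : d ≠ 0 := by
    intro h
    rw [h, map_zero] at hdv
    exact WithZero.zero_ne_coe hdv
  exact closureEmb_geomSqrt_not_mem_maxUnramified v hd (exists_uniformizer_sq_mul_of_valuation_eq v hdv)

/-- Over `ℚ`, prime-twist spelling: for a prime `ℓ` under `v` and `d = ℓ` or `d = -ℓ`, `closureEmb(√d) ∉ ℚ_v^{nr}`.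
[folklore] -/
theorem closureEmb_geomSqrt_not_mem_maxUnramified_prime (v : HeightOneSpectrum (𝓞 ℚ)) {ℓ : ℕ} (hℓ : ℓ.Prime)
    (hv : (ℓ : 𝓞 ℚ) ∈ v.asIdeal) {d : ℚ} (hdℓ : d = ℓ ∨ d = -(ℓ : ℚ)) :
    closureEmb (K := ℚ) (v.adicCompletion ℚ) (geomSqrt d) ∉
      IsNonarchimedeanLocalField.maxUnramified (v.adicCompletion ℚ) := by
  have hdv : v.valuation ℚ d = WithZero.exp (-1 : ℤ) := by
    rcases hdℓ with rfl | rfl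
    · exact valuation_natCast_eq_exp_neg_one_of_mem v hℓ hv
    · exact valuation_neg_natCast_eq_exp_neg_one_of_mem v hℓ hv
  exact closureEmb_geomSqrt_not_mem_maxUnramified_rat v hdv

end Bridge

end Summit.BirchSwinnertonDyer.BirchSwinnertonDyer.Theorems.GenusKolyTwistRamified

end
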